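import Summits.Ventures.PercRepro2.CaseOneRootsAndBQ
import Summits.Ventures.PercRepro2.CaseOneDWorldIEdge

/-!
# `(ii-Q)` is free of the root edges at `a₃`: the class predicate `OddsAll` and its closure
(blind cell PercRepro2, p1 g28; S5 §2.3 — the Q-pair analogue of `zSplitIID_of_rootFree`)

**`OddsAll p a₃`** := the D-world `(ii)` of `a₃` is nonnegative at EVERY pair `(c₀, c₁)` with `c₁ ≥ 0`
satisfying the odds condition `c₁ · P(Q, a₃ ∈ C₁, o ∈ C₂) ≤ c₀ · P(Q, a₃ ∈ C₁)`. At the Q pair the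
condition is `odds_q`, so `OddsAll ⟹ (ii-Q)` (**`zSplitIIQ_of_oddsAll`**). The predicate is closed
under adding root edges at `a₃` (**`oddsAll_of_a1_edge`**, **`oddsAll_of_a2_edge`**: identities (E),
(E′) with the transported odds condition of `CaseOneRootsAndBQ`), hence **`oddsAll_of_pinRoots`**:
`OddsAll` for `p` follows from `OddsAll` for `pinRoots p`, the weight vector with every root edge at
`a₃` null — `(ii-Q)` is free of the root edges at `a₃`, as `(ii)` is (`zSplitIID_of_rootFree`). It is
also closed under the pendant step (**`oddsAll_of_leaf_supp`**: `a₃` a leaf at `v` in the support,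
identity (L) `iiExprD_leaf_supp` with the one-line lemma), and it holds for the three bases — `a₃`
isolated in the support (**`oddsAll_of_null`**), a leaf at `o` (**`oddsAll_of_leaf_supp_o`**), a leaf
at `b` (**`oddsAll_of_leaf_supp_b`**). Consequences: `OddsAll` on the root-only, roots-and-`o`,
roots-and-`b` classes (**`oddsAll_of_rootsOnly`**, **`oddsAll_of_rootsAndO`**,
**`oddsAll_of_rootsAndB`**), on `a₃` adjacent to the roots and to one further vertex `v` of any of
these classes (**`oddsAll_of_rootsAndLeaf`**), and the `(ii-Q)` rows of the two-level classes
(**`zSplitIIQ_of_rootsAndLeaf_rootsOnly`**, **`zSplitIIQ_of_rootsAndLeaf_rootsAndO`**,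
**`zSplitIIQ_of_rootsAndLeaf_rootsAndB`**). Own code; standard axioms.
-/

namespace Summit.Ventures.PercRepro2

namespace CaseOne

/-! ## The predicate and `(ii-Q)` -/

section Defs
variable {V : Type*} {E : Type*} [Fintype E] [DecidableEq E] {R : Type*} [CommRing R] [LinearOrder R]

/-- **The D-world `(ii)` at every admissible pair**: for every `(c₀, c₁)` with `c₁ ≥ 0` and
`c₁ · P(Q, a₃ ∈ C₁, o ∈ C₂) ≤ c₀ · P(Q, a₃ ∈ C₁)`, `0 ≤ iiExprD p c₀ c₁`. A definition only. -/
def OddsAll (p : E → R) (ends : E → Sym2 V) (o a₁ a₂ a₃ b : V) : Prop :=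
  ∀ c₀ c₁ : R, 0 ≤ c₁ →
    c₁ * prob p (connEvent ends a₁ a₃ ∩ connEvent ends a₂ o ∩ (connEvent ends a₁ a₂)ᶜ) ≤
      c₀ * prob p (connEvent ends a₁ a₃ ∩ (connEvent ends a₁ a₂)ᶜ) →
    0 ≤ iiExprD p ends o a₁ a₂ a₃ b c₀ c₁

end Defs

section Basic
variable {V : Type*} {E : Type*} [Fintype E] [DecidableEq E] [Fintype V] [DecidableEq V]
  {R : Type*} [Field R] [LinearOrder R] [IsStrictOrderedRing R]
variable {ends : E → Sym2 V} {o a₁ a₂ a₃ b : V}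

/-- **`OddsAll ⟹ (ii-Q)`**: at the Q pair the odds condition is `odds_q`. -/
theorem zSplitIIQ_of_oddsAll (p : E → R) (hp : IsProbVec p) (h : OddsAll p ends o a₁ a₂ a₃ b) :
    ZSplitIIQ p ends o a₁ a₂ a₃ b := by
  unfold ZSplitIIQ
  exact iiExprT_nonneg_of_dworld p hp ends o a₁ a₂ a₃ b _ _
    (h _ _ (prob_nonneg hp _) (odds_q p hp ends o a₁ a₂ a₃)) (odds_q p hp ends o a₁ a₂ a₃)

/-- **`OddsAll` lifts along an `a₁a₃`-edge** (identity (E), `covDw_nonneg`, `odds_of_a1_edge`). -/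
theorem oddsAll_of_a1_edge (p : E → R) (hp : IsProbVec p) {e₁ : E} (he : ends e₁ = s(a₁, a₃))
    (h : OddsAll (Function.update p e₁ 0) ends o a₁ a₂ a₃ b) : OddsAll p ends o a₁ a₂ a₃ b := by
  intro c₀ c₁ hc₁ hodds
  have hp0 : IsProbVec (Function.update p e₁ 0) := hp.update e₁ le_rfl zero_le_one
  have hrec := h c₀ c₁ hc₁ (odds_of_a1_edge p hp he o c₀ c₁ hc₁ hodds)
  rw [iiExprD_a1_edge p he o b c₀ c₁]
  have hcov := covDw_nonneg (Function.update p e₁ 0) hp0 ends o a₁ a₂ a₃ b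
  have hpe : 0 ≤ p e₁ := hp.nonneg e₁
  have hpe' : 0 ≤ 1 - p e₁ := sub_nonneg.2 (hp.le_one e₁)
  have t1 := mul_nonneg (mul_nonneg hpe hc₁) hcov
  have t2 := mul_nonneg hpe' hrec
  linarith [t1, t2]

omit [Fintype V] [DecidableEq V] in
/-- **`OddsAll` lifts along an `a₂a₃`-edge** (identity (E′), `odds_of_a2_edge`; at weight `1` the
D-world `(ii)` vanishes). -/
theorem oddsAll_of_a2_edge (p : E → R) (hp : IsProbVec p) {e₂ : E} (he : ends e₂ = s(a₂, a₃))
    (h : OddsAll (Function.update p e₂ 0) ends o a₁ a₂ a₃ b) : OddsAll p ends o a₁ a₂ a₃ b := by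
  intro c₀ c₁ hc₁ hodds
  rw [iiExprD_a2_edge p he o b c₀ c₁]
  have hpe' : 0 ≤ 1 - p e₂ := sub_nonneg.2 (hp.le_one e₂)
  rcases (hp.le_one e₂).lt_or_eq with hlt | heq
  · exact mul_nonneg (pow_nonneg hpe' 2) (h c₀ c₁ hc₁ (odds_of_a2_edge p he o c₀ c₁ hlt hodds))
  · rw [heq]
    simp

end Basic

/-! ## The root edges at `a₃` are free -/

section PinRootsDefs
variable {V : Type*} {E : Type*} [DecidableEq E] [DecidableEq V] {R : Type*} [CommRing R]
variable {ends : E → Sym2 V} {a₁ a₂ a₃ : V}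

omit [DecidableEq E] in
/-- **The weight vector with every root edge at `a₃` null.** -/
def pinRoots (p : E → R) (ends : E → Sym2 V) (a₁ a₂ a₃ : V) : E → R :=
  fun e => if ends e = s(a₁, a₃) ∨ ends e = s(a₂, a₃) then 0 else p e

/-- Pinning a root edge does not change `pinRoots`. -/
lemma pinRoots_update (p : E → R) {e : E} (he : ends e = s(a₁, a₃) ∨ ends e = s(a₂, a₃)) :
    pinRoots (Function.update p e 0) ends a₁ a₂ a₃ = pinRoots p ends a₁ a₂ a₃ := by
  funext e'
  simp only [pinRoots]
  by_cases h : e' = e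
  · subst h
    simp [he]
  · rw [Function.update_of_ne h]

omit [DecidableEq E] in
/-- With every root edge at `a₃` null, `pinRoots p = p`. -/
lemma pinRoots_eq_self (p : E → R)
    (h0 : ∀ e, ends e = s(a₁, a₃) ∨ ends e = s(a₂, a₃) → p e = 0) :
    pinRoots p ends a₁ a₂ a₃ = p := by
  funext e
  simp only [pinRoots]
  split_ifs with h
  · exact (h0 e h).symm
  · rfl

omit [DecidableEq E] in
/-- Every root edge at `a₃` is null in `pinRoots p`. -/
lemma pinRoots_root_eq_zero (p : E → R) {e : E}
    (he : ends e = s(a₁, a₃) ∨ ends e = s(a₂, a₃)) : pinRoots p ends a₁ a₂ a₃ e = 0 := by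
  simp [pinRoots, he]

omit [DecidableEq E] in
/-- A non-root edge keeps its weight in `pinRoots p`. -/
lemma pinRoots_of_not_root (p : E → R) {e : E}
    (he : ¬ (ends e = s(a₁, a₃) ∨ ends e = s(a₂, a₃))) : pinRoots p ends a₁ a₂ a₃ e = p e := by
  simp [pinRoots, he]

end PinRootsDefs

section PinRoots
variable {V : Type*} {E : Type*} [Fintype E] [DecidableEq E] [Fintype V] [DecidableEq V]
  {R : Type*} [Field R] [LinearOrder R] [IsStrictOrderedRing R]
variable {ends : E → Sym2 V} {o a₁ a₂ a₃ b : V}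

omit [Fintype E] [DecidableEq E] [Fintype V] in
/-- `pinRoots` keeps the weights admissible. -/
lemma isProbVec_pinRoots {p : E → R} (hp : IsProbVec p) :
    IsProbVec (pinRoots p ends a₁ a₂ a₃) := by
  refine ⟨fun e => ?_, fun e => ?_⟩ <;> simp only [pinRoots] <;> split_ifs
  · exact le_rfl
  · exact hp.nonneg e
  · exact zero_le_one
  · exact hp.le_one e

/-- **`(ii-Q)` is free of the root edges at `a₃`**: `OddsAll` for `p` follows from `OddsAll` for the
weight vector with every root edge at `a₃` null. -/
theorem oddsAll_of_pinRoots (p : E → R) (hp : IsProbVec p)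
    (h : OddsAll (pinRoots p ends a₁ a₂ a₃) ends o a₁ a₂ a₃ b) : OddsAll p ends o a₁ a₂ a₃ b := by
  generalize hn : (Finset.univ.filter fun e' => (ends e' = s(a₁, a₃) ∨ ends e' = s(a₂, a₃)) ∧
    p e' ≠ 0).card = n
  induction n using Nat.strong_induction_on generalizing p with
  | _ n ih =>
    by_cases h0 : (Finset.univ.filter fun e' => (ends e' = s(a₁, a₃) ∨ ends e' = s(a₂, a₃)) ∧
        p e' ≠ 0) = ∅
    · have hnull : ∀ e, ends e = s(a₁, a₃) ∨ ends e = s(a₂, a₃) → p e = 0 := by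
        intro e he
        by_contra hc
        have : e ∈ (Finset.univ.filter fun e' => (ends e' = s(a₁, a₃) ∨ ends e' = s(a₂, a₃)) ∧
            p e' ≠ 0) := by simp [he, hc]
        rw [h0] at this
        exact absurd this (Finset.notMem_empty e)
      rw [pinRoots_eq_self p hnull] at h
      exact h
    · obtain ⟨e, he⟩ := Finset.nonempty_iff_ne_empty.mpr h0
      have he' : ends e = s(a₁, a₃) ∨ ends e = s(a₂, a₃) := by
        have := he
        simp only [Finset.mem_filter, Finset.mem_univ, true_and] at this
        exact this.1
      have hlt : ((Finset.univ.filter fun e' => (ends e' = s(a₁, a₃) ∨ ends e' = s(a₂, a₃)) ∧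
          p e' ≠ 0).erase e).card < n := by
        rw [← hn]; exact Finset.card_erase_lt_of_mem he
      have hp0 : IsProbVec (Function.update p e 0) := hp.update e le_rfl zero_le_one
      have h' : OddsAll (pinRoots (Function.update p e 0) ends a₁ a₂ a₃) ends o a₁ a₂ a₃ b := by
        rw [pinRoots_update p he']
        exact h
      have hrec := ih _ hlt (Function.update p e 0) hp0 h' (by rw [filter_liveRoot_update])
      rcases he' with h1 | h1
      · exact oddsAll_of_a1_edge p hp h1 hrec
      · exact oddsAll_of_a2_edge p hp h1 hrec

end PinRoots

/-! ## The bases and the pendant step -/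

section Bases
variable {V : Type*} {E : Type*} [Fintype E] [DecidableEq E] [Fintype V] [DecidableEq V]
  {R : Type*} [Field R] [LinearOrder R] [IsStrictOrderedRing R]
variable {ends : E → Sym2 V} {o a₁ a₂ a₃ b : V}

omit [Fintype V] [DecidableEq V] [IsStrictOrderedRing R] in
/-- **`a₃` isolated in the support**: `OddsAll` (the D-world `(ii)` vanishes). -/
theorem oddsAll_of_null (p : E → R) (hnull : ∀ e, a₃ ∈ ends e → p e = 0) (h1 : a₁ ≠ a₃) :
    OddsAll p ends o a₁ a₂ a₃ b := by
  intro c₀ c₁ _ _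
  simp [iiExprD_eq_zero_of_null p hnull h1]

omit [Fintype V] [DecidableEq V] in
/-- The `A`-masses vanish when `P(Q, a₃ ∈ C₁) = 0`, and so does `iiExprD`. -/
lemma iiExprD_eq_zero_of_A (p : E → R) (hp : IsProbVec p)
    (hX : prob p (connEvent ends a₁ a₃ ∩ (connEvent ends a₁ a₂)ᶜ) = 0) (c₀ c₁ : R) :
    iiExprD p ends o a₁ a₂ a₃ b c₀ c₁ = 0 := by
  rw [iiExprD_eq]
  have z : ∀ X : Set (Config E), X ⊆ connEvent ends a₁ a₃ ∩ (connEvent ends a₁ a₂)ᶜ →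
      prob p X = 0 := fun X hX' => le_antisymm (hX ▸ prob_mono hp hX') (prob_nonneg hp X)
  rw [z (connEvent ends a₂ b ∩ connEvent ends a₁ a₃ ∩ connEvent ends a₂ o ∩
      (connEvent ends a₁ a₂)ᶜ) (fun _ h => ⟨h.1.1.2, h.2⟩),
    z (connEvent ends a₁ a₃ ∩ connEvent ends a₂ o ∩ (connEvent ends a₁ a₂)ᶜ)
      (fun _ h => ⟨h.1.1, h.2⟩),
    z (connEvent ends a₂ b ∩ connEvent ends a₁ a₃ ∩ (connEvent ends a₁ a₂)ᶜ)
      (fun _ h => ⟨h.1.2, h.2⟩), hX]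
  ring

/-- **`a₃` a leaf at `o` in the support**: `OddsAll` (`iiExprD_nonneg_of_leaf_supp_o` at `c₀ ≥ 0`;
the odds condition forces `c₀ ≥ 0` unless `P(Q, a₃ ∈ C₁) = 0`, where `iiExprD = 0`). -/
theorem oddsAll_of_leaf_supp_o (p : E → R) (hp : IsProbVec p) {e₀ : E}
    (hl : IsLeafSupp p ends o a₃ e₀) (h1 : a₁ ≠ a₃) : OddsAll p ends o a₁ a₂ a₃ b := by
  intro c₀ c₁ hc₁ hodds
  rcases (prob_nonneg hp (connEvent ends a₁ a₃ ∩ (connEvent ends a₁ a₂)ᶜ)).lt_or_eq with hX | hX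
  · have hY := prob_nonneg hp (connEvent ends a₁ a₃ ∩ connEvent ends a₂ o ∩
      (connEvent ends a₁ a₂)ᶜ)
    have hc₀ : 0 ≤ c₀ := by
      by_contra hc
      rw [not_le] at hc
      have : c₀ * prob p (connEvent ends a₁ a₃ ∩ (connEvent ends a₁ a₂)ᶜ) < 0 :=
        mul_neg_of_neg_of_pos hc hX
      linarith [mul_nonneg hc₁ hY]
    exact iiExprD_nonneg_of_leaf_supp_o hp hl h1 b c₀ c₁ hc₀
  · simp [iiExprD_eq_zero_of_A p hp hX.symm]

omit [Fintype V] [DecidableEq V] in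
/-- **`a₃` a leaf at `b` in the support**: `OddsAll` (`iiExprD_nonneg_of_leaf_supp_b`). -/
theorem oddsAll_of_leaf_supp_b (p : E → R) (hp : IsProbVec p) {e₀ : E}
    (hl : IsLeafSupp p ends b a₃ e₀) (h1 : a₁ ≠ a₃) : OddsAll p ends o a₁ a₂ a₃ b :=
  fun c₀ c₁ _ hodds => iiExprD_nonneg_of_leaf_supp_b hp hl h1 o c₀ c₁ hodds

/-- **The pendant step**: if `a₃` is a leaf at `v` in the support of `p` and `OddsAll` holds for `v`
in `G − a₃` (weights `p[e₀ ↦ 0]`), then `OddsAll` holds for `a₃` (identity (L) and the one-line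
lemma). -/
theorem oddsAll_of_leaf_supp (p : E → R) (hp : IsProbVec p) {v : V} {e₀ : E}
    (hl : IsLeafSupp p ends v a₃ e₀) (ho : o ≠ a₃) (h1 : a₁ ≠ a₃) (h2 : a₂ ≠ a₃) (hb : b ≠ a₃)
    (hv : OddsAll (Function.update p e₀ 0) ends o a₁ a₂ v b) : OddsAll p ends o a₁ a₂ a₃ b := by
  intro c₀ c₁ hc₁ hodds
  have hp' : IsProbVec (Function.update p e₀ 0) := hp.update e₀ le_rfl zero_le_one
  have hr0 : 0 ≤ p e₀ := hp.nonneg e₀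
  have hr1 : 0 ≤ 1 - p e₀ := by linarith [hp.le_one e₀]
  rw [iiExprD_leaf_supp hl ho h1 h2 hb]
  -- the two `A`-masses of `a₃` carry the factor `p e₀`
  have hX := prob_A_leaf_supp hl h1 h2 Set.univ (fun _ _ => Iff.rfl)
  rw [Set.univ_inter, Set.univ_inter] at hX
  have hY := prob_A_leaf_supp hl h1 h2 (connEvent ends a₂ o) (a2_conn_good hl h2 ho)
  have e1 : connEvent ends a₂ o ∩ connEvent ends a₁ a₃ ∩ (connEvent ends a₁ a₂)ᶜ =
      connEvent ends a₁ a₃ ∩ connEvent ends a₂ o ∩ (connEvent ends a₁ a₂)ᶜ := by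
    ext ω; simp only [Set.mem_inter_iff]; tauto
  have e2 : connEvent ends a₂ o ∩ connEvent ends a₁ v ∩ (connEvent ends a₁ a₂)ᶜ =
      connEvent ends a₁ v ∩ connEvent ends a₂ o ∩ (connEvent ends a₁ a₂)ᶜ := by
    ext ω; simp only [Set.mem_inter_iff]; tauto
  rw [e1, e2] at hY
  rw [hX, hY] at hodds
  -- the odds condition for `v` at `p[e₀ ↦ 0]` (trivial when `p e₀ = 0`)
  rcases hr0.lt_or_eq with hr | hr
  · have hodds' : c₁ * prob (Function.update p e₀ 0)
        (connEvent ends a₁ v ∩ connEvent ends a₂ o ∩ (connEvent ends a₁ a₂)ᶜ) ≤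
        c₀ * prob (Function.update p e₀ 0) (connEvent ends a₁ v ∩ (connEvent ends a₁ a₂)ᶜ) := by
      have h := hodds
      have : p e₀ * (c₁ * prob (Function.update p e₀ 0)
          (connEvent ends a₁ v ∩ connEvent ends a₂ o ∩ (connEvent ends a₁ a₂)ᶜ)) ≤
          p e₀ * (c₀ * prob (Function.update p e₀ 0)
            (connEvent ends a₁ v ∩ (connEvent ends a₁ a₂)ᶜ)) := by linarith [h]
      exact le_of_mul_le_mul_left this hr
    have hD := hv c₀ c₁ hc₁ hodds'
    have hT := iiExprT_nonneg_of_dworld (Function.update p e₀ 0) hp' ends o a₁ a₂ v b _ _ hD hodds'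
    exact mul_nonneg hr0 (add_nonneg (mul_nonneg hr1 hT) (mul_nonneg hr0 hD))
  · rw [← hr]
    simp

end Bases

/-! ## The classes -/

section Classes
variable {V : Type*} {E : Type*} [Fintype E] [DecidableEq E] [Fintype V] [DecidableEq V]
  {R : Type*} [Field R] [LinearOrder R] [IsStrictOrderedRing R]
variable {ends : E → Sym2 V} {o a₁ a₂ a₃ b : V}

/-- **Root-only `a₃`** (every non-null edge at `a₃` joins a root, any multiplicities): `OddsAll`. -/
theorem oddsAll_of_rootsOnly (p : E → R) (hp : IsProbVec p)
    (hroot : ∀ e, a₃ ∈ ends e → p e ≠ 0 → ends e = s(a₁, a₃) ∨ ends e = s(a₂, a₃)) (h1 : a₁ ≠ a₃) :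
    OddsAll p ends o a₁ a₂ a₃ b := by
  refine oddsAll_of_pinRoots p hp (oddsAll_of_null _ (fun e he => ?_) h1)
  by_cases hr : ends e = s(a₁, a₃) ∨ ends e = s(a₂, a₃)
  · exact pinRoots_root_eq_zero p hr
  · rw [pinRoots_of_not_root p hr]
    by_contra hne
    exact hr (hroot e he hne)

omit [Fintype E] [DecidableEq E] [Fintype V] [LinearOrder R] [IsStrictOrderedRing R] in
/-- The leaf structure of `pinRoots p` when every edge at `a₃` other than `e₀ = {v, a₃}` is a root
edge. -/
lemma isLeafSupp_pinRoots (p : E → R) {v : V} {e₀ : E} (he₀ : ends e₀ = s(v, a₃))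
    (hroot : ∀ e, a₃ ∈ ends e → e ≠ e₀ → ends e = s(a₁, a₃) ∨ ends e = s(a₂, a₃)) (hv : v ≠ a₃) :
    IsLeafSupp (pinRoots p ends a₁ a₂ a₃) ends v a₃ e₀ :=
  ⟨he₀, fun e he hne => pinRoots_root_eq_zero p (hroot e he hne), hv⟩

/-- **Roots-and-`o`**: `OddsAll` for `a₃` adjacent to the roots (any multiplicities) and to `o`. -/
theorem oddsAll_of_rootsAndO (p : E → R) (hp : IsProbVec p) {e₀ : E} (he₀ : ends e₀ = s(o, a₃))
    (hroot : ∀ e, a₃ ∈ ends e → e ≠ e₀ → ends e = s(a₁, a₃) ∨ ends e = s(a₂, a₃)) (ho : o ≠ a₃)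
    (h1 : a₁ ≠ a₃) : OddsAll p ends o a₁ a₂ a₃ b :=
  oddsAll_of_pinRoots p hp
    (oddsAll_of_leaf_supp_o _ (isProbVec_pinRoots hp) (isLeafSupp_pinRoots p he₀ hroot ho) h1)

/-- **Roots-and-`b`**: `OddsAll` for `a₃` adjacent to the roots (any multiplicities) and to `b`
(the predicate form of `iiExprD_nonneg_of_rootsAndB`). -/
theorem oddsAll_of_rootsAndB (p : E → R) (hp : IsProbVec p) {e₀ : E} (he₀ : ends e₀ = s(b, a₃))
    (hroot : ∀ e, a₃ ∈ ends e → e ≠ e₀ → ends e = s(a₁, a₃) ∨ ends e = s(a₂, a₃)) (hb : b ≠ a₃)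
    (h1 : a₁ ≠ a₃) : OddsAll p ends o a₁ a₂ a₃ b :=
  oddsAll_of_pinRoots p hp
    (oddsAll_of_leaf_supp_b _ (isProbVec_pinRoots hp) (isLeafSupp_pinRoots p he₀ hroot hb) h1)

/-- **Roots and one further vertex `v`**: if every edge at `a₃` other than `e₀ = {v, a₃}` joins a root
and `OddsAll` holds for `v` in `G − a₃` (the weight vector with every edge at `a₃` null), then
`OddsAll` holds for `a₃`. -/
theorem oddsAll_of_rootsAndLeaf (p : E → R) (hp : IsProbVec p) {v : V} {e₀ : E}
    (he₀ : ends e₀ = s(v, a₃))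
    (hroot : ∀ e, a₃ ∈ ends e → e ≠ e₀ → ends e = s(a₁, a₃) ∨ ends e = s(a₂, a₃)) (hv : v ≠ a₃)
    (ho : o ≠ a₃) (h1 : a₁ ≠ a₃) (h2 : a₂ ≠ a₃) (hb : b ≠ a₃)
    (hvb : OddsAll (Function.update (pinRoots p ends a₁ a₂ a₃) e₀ 0) ends o a₁ a₂ v b) :
    OddsAll p ends o a₁ a₂ a₃ b :=
  oddsAll_of_pinRoots p hp
    (oddsAll_of_leaf_supp _ (isProbVec_pinRoots hp) (isLeafSupp_pinRoots p he₀ hroot hv) ho h1 h2 hb hvb)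

/-- **`(ii-Q)` for `a₃` adjacent to the roots (any multiplicities) and to `v`, where every other edge
at `v` joins a root (any multiplicities).** -/
theorem zSplitIIQ_of_rootsAndLeaf_rootsOnly (p : E → R) (hp : IsProbVec p) {v : V} {e₀ : E}
    (he₀ : ends e₀ = s(v, a₃))
    (hroot : ∀ e, a₃ ∈ ends e → e ≠ e₀ → ends e = s(a₁, a₃) ∨ ends e = s(a₂, a₃))
    (hvroot : ∀ e, v ∈ ends e → e ≠ e₀ → ends e = s(a₁, v) ∨ ends e = s(a₂, v)) (hv : v ≠ a₃)
    (ho : o ≠ a₃) (h1 : a₁ ≠ a₃) (h2 : a₂ ≠ a₃) (hb : b ≠ a₃) (h1v : a₁ ≠ v) :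
    ZSplitIIQ p ends o a₁ a₂ a₃ b := by
  refine zSplitIIQ_of_oddsAll p hp (oddsAll_of_rootsAndLeaf p hp he₀ hroot hv ho h1 h2 hb ?_)
  have hp' : IsProbVec (Function.update (pinRoots p ends a₁ a₂ a₃) e₀ 0) :=
    (isProbVec_pinRoots hp).update e₀ le_rfl zero_le_one
  refine oddsAll_of_rootsOnly _ hp' (fun e he hne => ?_) h1v
  by_cases h : e = e₀
  · subst h
    simp at hne
  · exact hvroot e he h

/-- **`(ii-Q)` for `a₃` adjacent to the roots and to `v`, where `v` is adjacent to the roots (any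
multiplicities) and to `o` through `e₁`.** -/
theorem zSplitIIQ_of_rootsAndLeaf_rootsAndO (p : E → R) (hp : IsProbVec p) {v : V} {e₀ e₁ : E}
    (he₀ : ends e₀ = s(v, a₃)) (he₁ : ends e₁ = s(o, v))
    (hroot : ∀ e, a₃ ∈ ends e → e ≠ e₀ → ends e = s(a₁, a₃) ∨ ends e = s(a₂, a₃))
    (hvroot : ∀ e, v ∈ ends e → e ≠ e₀ → e ≠ e₁ → ends e = s(a₁, v) ∨ ends e = s(a₂, v))
    (hv : v ≠ a₃) (ho : o ≠ a₃) (h1 : a₁ ≠ a₃) (h2 : a₂ ≠ a₃) (hb : b ≠ a₃) (h1v : a₁ ≠ v)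
    (hov : o ≠ v) : ZSplitIIQ p ends o a₁ a₂ a₃ b := by
  refine zSplitIIQ_of_oddsAll p hp (oddsAll_of_rootsAndLeaf p hp he₀ hroot hv ho h1 h2 hb ?_)
  have hp' : IsProbVec (Function.update (pinRoots p ends a₁ a₂ a₃) e₀ 0) :=
    (isProbVec_pinRoots hp).update e₀ le_rfl zero_le_one
  refine oddsAll_of_pinRoots _ hp' (oddsAll_of_leaf_supp_o _ (isProbVec_pinRoots hp') ⟨he₁, fun e he hne => ?_, hov⟩ h1v)
  by_cases hr : ends e = s(a₁, v) ∨ ends e = s(a₂, v)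
  · exact pinRoots_root_eq_zero _ hr
  · rw [pinRoots_of_not_root _ hr]
    by_cases h : e = e₀
    · subst h
      simp
    · exact absurd (hvroot e he h hne) hr

/-- **`(ii-Q)` for `a₃` adjacent to the roots and to `v`, where `v` is adjacent to the roots (any
multiplicities) and to `b` through `e₁`.** -/
theorem zSplitIIQ_of_rootsAndLeaf_rootsAndB (p : E → R) (hp : IsProbVec p) {v : V} {e₀ e₁ : E}
    (he₀ : ends e₀ = s(v, a₃)) (he₁ : ends e₁ = s(b, v))
    (hroot : ∀ e, a₃ ∈ ends e → e ≠ e₀ → ends e = s(a₁, a₃) ∨ ends e = s(a₂, a₃))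
    (hvroot : ∀ e, v ∈ ends e → e ≠ e₀ → e ≠ e₁ → ends e = s(a₁, v) ∨ ends e = s(a₂, v))
    (hv : v ≠ a₃) (ho : o ≠ a₃) (h1 : a₁ ≠ a₃) (h2 : a₂ ≠ a₃) (hb : b ≠ a₃) (h1v : a₁ ≠ v)
    (hbv : b ≠ v) : ZSplitIIQ p ends o a₁ a₂ a₃ b := by
  refine zSplitIIQ_of_oddsAll p hp (oddsAll_of_rootsAndLeaf p hp he₀ hroot hv ho h1 h2 hb ?_)
  have hp' : IsProbVec (Function.update (pinRoots p ends a₁ a₂ a₃) e₀ 0) :=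
    (isProbVec_pinRoots hp).update e₀ le_rfl zero_le_one
  refine oddsAll_of_pinRoots _ hp' (oddsAll_of_leaf_supp_b _ (isProbVec_pinRoots hp') ⟨he₁, fun e he hne => ?_, hbv⟩ h1v)
  by_cases hr : ends e = s(a₁, v) ∨ ends e = s(a₂, v)
  · exact pinRoots_root_eq_zero _ hr
  · rw [pinRoots_of_not_root _ hr]
    by_cases h : e = e₀
    · subst h
      simp
    · exact absurd (hvroot e he h hne) hr

end Classes

end CaseOne

end Summit.Ventures.PercRepro2
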